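import Mathlib
import HarnessLib
import HarnessLib.Audit
import Summits.NavierStokesRegularity.NavierStokesRegularity.Theses.L3TimeExponentPincer
import Summits.NavierStokesRegularity.NavierStokesRegularity.Theses.TypeILiouville
import Summits.NavierStokesRegularity.NavierStokesRegularity.Theorems.TypeICertificateLadderNoTypeIBlowupMorrey
import Summits.NavierStokesRegularity.NavierStokesRegularity.Theorems.L3TimeExponentPincerSubparabolicMorreyJaw
import Summits.NavierStokesRegularity.NavierStokesRegularity.Theorems.L3TimeExponentPincerPaceDichotomy
import Summits.NavierStokesRegularity.NavierStokesRegularity.Theorems.L3TimeExponentPincerNoBlowupToClay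
import Literature.Analysis.FluidPDE.LiouvilleExcludesLocalTypeI

/-!
# Hard-core meet for the Morrey classes of line `pace` (crux `EffSatBlowup`,
# item `stmt-NavierStokesRegularity-19139`, route `L3TimeExponentPincer`)

Support file (theorems only, no definition, no `sorry`; `--supports stmt-NavierStokesRegularity-19139`,
seat ns-pincer-19139-p1, gen 2).  Line `pace` splits the crux by the Morrey-Type-I bound of
Barker–Prange 2020 (1.7): stub 2 = `MorreyTypeISlowB` ("Morrey-Type-I frame blow-ups are `L³`-slow",
class `MorreyTypeINear`: top windows `T - r² < t < T`), stub 3 = the non-Morrey-Type-I class.  The cell's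
J′ class is the FULL Morrey bound `FullMorreyTypeINear` (all late times, all radii `< r₁`) =
`MorreyTypeINear ∧ SubparabolicMorreyNear` (`fullMorreyTypeINear_of_morreyTypeI_of_subparabolic`).

This file places the FULL-Morrey part of stub 2's class under the tree's registered open statement
`¬ Literature.Analysis.FluidPDE.LocalTypeISingularityExists` ("no suitable weak solution has a local
Type I singular point", Albritton–Barker 2019, Thm. 1.1, first bullet, negated) and hence under hard core
`stmt-NavierStokesRegularity-10661` = `Theses.TypeILiouville.TypeIliouvilleL` (the KNSS Liouville conjecture
(L)), BY NAME, by composing three kernel theorems that already exist in the tree: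

* `Theorems.isBackwardBoundedAt_of_morrey_of_not_localTypeISingularityExists` (route
  TypeICertificateLadder: under a full Morrey bound every final-time point `(T, x₀)` carries a bounded
  backward cylinder, else the viscosity-normalising zoom has a local Type I singular point at the origin —
  Albritton–Barker Lemma 2.6 bounds `C, D, E` from `A` on all parabolic sub-balls);
* `Literature.Analysis.FluidPDE.hasSmoothExtensionPast_of_forall_exists_parabolicCylinder`
  (Lemarié-Rieusset 2016, Thm. 15.1 (C): bounded backward cylinders at every `(T, x₀)` continue the
  classical Leray–Hopf solution past `T`; the far field is handled there);
* `Literature.Analysis.FluidPDE.not_localTypeISingularityExists_of_liouvilleConjectureNS`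
  ((L) ⇒ no local Type I singular point, through the kernel-checked Albritton–Barker forward blow-up).

Results (all CONDITIONAL on the displayed hypothesis `¬ LocalTypeISingularityExists` resp. (L); nothing
here closes item 19139 or asserts anything about Navier–Stokes regularity):

* `hasSmoothExtensionPast_of_fullMorreyTypeINear` — **a Full-Morrey frame solution extends past `T`**;
  `not_fullMorreyTypeINear_of_blowup` — **J′'s class is EMPTY on the blow-up branch**;
  `not_subparabolicMorreyNear_of_morreyTypeI_blowup` — a Morrey-Type-I (top windows) frame blow-up is
  sub-parabolically Morrey-Type-II: `∫_{B(x₀,r)}|u(t)|² ≤ M r` FAILS along sub-parabolic balls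
  `r ≤ √(T-t)` for every `M` (deep `L²` concentration below the parabolic scale);
* `morreyTypeISlowB_iff_residual` — **stub 2 ≡ its sub-parabolic-Type-II residual**: `MorreyTypeISlowB`
  (the registered stub signature) is equivalent to the same statement restricted to
  `MorreyTypeINear ∧ ¬ SubparabolicMorreyNear` blow-ups; `effSatBlowupMTI_iff_residual` — the same for
  the crux on the MTI class (`EffSatBlowupMTI`);
* `navierStokesRegularity_of_allBlowupsFullMorreyB` — the parent jaw's Morrey-side node
  `AllBlowupsFullMorreyB` ("every frame blow-up is Full-Morrey", p4) gives Clay (A) outright under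
  `¬ LocalTypeISingularityExists`; `…_of_typeIliouvilleL` — the same under hard core 10661 BY NAME
  (a REDUCTION certificate, not a candidate proof: both hypotheses are open).

What the Morrey-Type-I hypothesis of stub 2 alone (top windows) does NOT give: Albritton–Barker's
neighbourhood quantity `𝐈(Q(z, r₀)) = sup over ALL parabolic sub-balls` — `MorreyTypeINear` bounds `A` only on
sub-balls whose vertex is a top point (`exists_zoom_sereginBounds_of_morreyTypeINear`, p455627: centred
`A+E+C+D ≤ K` at every `(T, x₀)`); sub-balls hanging below their vertex by more than their radius are exactly
the sub-parabolic balls, so the residual class `MorreyTypeINear ∧ ¬ SubparabolicMorreyNear` is where stub 2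
lives after this file.
References: D. Albritton, T. Barker, J. Math. Fluid Mech. 21 (2019), arXiv:1811.00502, Thm. 1.1, Lemma 2.6, §1;
G. Koch, N. Nadirashvili, G. Seregin, V. Šverák, Acta Math. 203 (2009), arXiv:0709.3599, §1;
P. G. Lemarié-Rieusset, The Navier–Stokes problem in the 21st century (2016), Thm. 15.1;
T. Barker, C. Prange, Arch. Ration. Mech. Anal. 236 (2020), arXiv:1812.09115, (1.7).
WHAT THIS IS NOT: not a proof of anything about Navier–Stokes regularity or blow-up; conditional reductions only.
-/

noncomputable section

namespace Summit.NavierStokesRegularity.NavierStokesRegularity.Theorems.L3TimeExponentPincerFullMorreyHardCoreMeet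

open MeasureTheory Set Function Filter Metric Topology
open scoped ENNReal NNReal
open Literature.Analysis.FluidPDE
open Summit.NavierStokesRegularity.NavierStokesRegularity.Theses.L3TimeExponentPincer (EffSatBlowup)
open Summit.NavierStokesRegularity.NavierStokesRegularity.Theorems.L3TimeExponentPincerPaceDichotomy
  (MorreyTypeINear L3Slow EffSatNear MorreyTypeISlowB EffSatBlowupMTI)
open Summit.NavierStokesRegularity.NavierStokesRegularity.Theorems.L3TimeExponentPincerJawFullMorrey
  (FullMorreyTypeINear AllBlowupsFullMorreyB)
open Summit.NavierStokesRegularity.NavierStokesRegularity.Theorems.L3TimeExponentPincerSubparabolicMorreyJaw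
  (SubparabolicMorreyNear fullMorreyTypeINear_of_morreyTypeI_of_subparabolic subparabolicMorreyNear_of_full)

variable {ν T : ℝ} {u : ℝ → EuclideanSpace ℝ (Fin 3) → EuclideanSpace ℝ (Fin 3)}
  {p : ℝ → EuclideanSpace ℝ (Fin 3) → ℝ}

/-! ## §1  The Full-Morrey class in the Bochner spelling of route TypeICertificateLadder -/

/-- A lower-Lebesgue Morrey bound `∫⁻_{B(x₁,ρ)} ‖u(t)‖ₑ² ≤ ofReal (M ρ)` on a Leray–Hopf slice
(`u t ∈ L²`) is the Bochner bound `∫_{B(x₁,ρ)} ‖u(t)‖² ≤ M ρ`. -/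
theorem setIntegral_ball_norm_sq_le_of_lintegral_le (hLH : IsLerayHopfOn T ν 0 (u 0) u)
    {t : ℝ} (ht : t ∈ Icc 0 T) (x₁ : EuclideanSpace ℝ (Fin 3)) {ρ M : ℝ} (hMρ : 0 ≤ M * ρ)
    (h : ∫⁻ x in ball x₁ ρ, ‖u t x‖ₑ ^ 2 ≤ ENNReal.ofReal (M * ρ)) :
    ∫ x in ball x₁ ρ, ‖u t x‖ ^ 2 ≤ M * ρ := by
  have hint : IntegrableOn (fun x => ‖u t x‖ ^ 2) (ball x₁ ρ) :=
    ((hLH.memLp t ht).integrable_norm_pow two_ne_zero).integrableOn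
  have e : ∫⁻ x in ball x₁ ρ, ‖u t x‖ₑ ^ 2 = ENNReal.ofReal (∫ x in ball x₁ ρ, ‖u t x‖ ^ 2) := by
    rw [ofReal_integral_eq_lintegral_ofReal hint (Eventually.of_forall fun x => by positivity)]
    refine lintegral_congr fun x => ?_
    rw [← ofReal_norm, ENNReal.ofReal_pow (norm_nonneg _)]
  rw [e] at h
  exact (ENNReal.ofReal_le_ofReal_iff hMρ).1 h

/-- **`FullMorreyTypeINear` in the Bochner spelling**: a Leray–Hopf solution on `[0, T)` in J′'s class
satisfies the Morrey hypothesis of `Theorems.isBackwardBoundedAt_of_morrey_of_not_localTypeISingularityExists`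
(all late times of a final interval inside `[0, T)`, all centres, all radii `≤ r₀`). -/
theorem exists_morreyBochner_of_fullMorreyTypeINear (hT : 0 < T) (hLH : IsLerayHopfOn T ν 0 (u 0) u)
    (hF : FullMorreyTypeINear u T) :
    ∃ r₀ M₀ T₁ : ℝ, 0 < r₀ ∧ T₁ < T ∧
      ∀ t ∈ Ioo T₁ T, ∀ (x₁ : EuclideanSpace ℝ (Fin 3)) (ρ : ℝ), 0 < ρ → ρ ≤ r₀ →
        ∫ x in ball x₁ ρ, ‖u t x‖ ^ 2 ≤ M₀ * ρ := by
  obtain ⟨M, hM, r₁, hr₁, T₁, hT₁, hMor⟩ := hF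
  refine ⟨r₁ / 2, M, max T₁ 0, by positivity, max_lt hT₁ hT, fun t ht x₁ ρ hρ hρr => ?_⟩
  have ht₁ : T₁ < t := lt_of_le_of_lt (le_max_left _ _) ht.1
  have ht0 : 0 < t := lt_of_le_of_lt (le_max_right _ _) ht.1
  exact setIntegral_ball_norm_sq_le_of_lintegral_le hLH ⟨ht0.le, ht.2.le⟩ x₁ (by positivity)
    (hMor t ⟨ht₁, ht.2⟩ x₁ ρ hρ (by linarith))

/-! ## §2  No Full-Morrey blow-up without a local Type I singular point -/

/-- **A Full-Morrey frame solution extends smoothly past `T`, if no local Type I singular point exists.**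
For a classical solution on `[0, T)` (viscosity `ν > 0`), Leray–Hopf on `[0, T)` from a rapidly decaying
datum, with `FullMorreyTypeINear u T`: every `(T, x₀)` carries a bounded backward cylinder
(`isBackwardBoundedAt_of_morrey_of_not_localTypeISingularityExists`: otherwise the zoom about `(T, x₀)` has a
local Type I singular point at its vertex — Albritton–Barker 2019, Lemma 2.6), and bounded backward
cylinders at every final-time point continue the solution (Lemarié-Rieusset 2016, Thm. 15.1 (C),
`hasSmoothExtensionPast_of_forall_exists_parabolicCylinder`).  CONDITIONAL on `hno`. -/
theorem hasSmoothExtensionPast_of_fullMorreyTypeINear (hno : ¬ LocalTypeISingularityExists)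
    (hν : 0 < ν) (hT : 0 < T) (hsol : IsClassicalNSSolutionOn (Ico 0 T) ν 0 u p)
    (hLH : IsLerayHopfOn T ν 0 (u 0) u) (hdec : HasRapidSpatialDecay (u 0))
    (hF : FullMorreyTypeINear u T) : HasSmoothExtensionPast ν 0 u T := by
  obtain ⟨r₀, M₀, T₁, hr₀, hT₁, hMor⟩ := exists_morreyBochner_of_fullMorreyTypeINear hT hLH hF
  refine hasSmoothExtensionPast_of_forall_exists_parabolicCylinder hν hT hsol hLH hdec fun x₀ => ?_
  obtain ⟨r, hr, K, hK⟩ :=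
    Summit.NavierStokesRegularity.NavierStokesRegularity.Theorems.isBackwardBoundedAt_of_morrey_of_not_localTypeISingularityExists
      hno hν hT hsol hLH hr₀ hT₁ hMor x₀
  refine ⟨r, hr, ?_⟩
  rw [eLpNorm_exponent_top]
  refine eLpNormEssSup_lt_top_of_ae_bound (C := K) ?_
  refine (ae_restrict_mem (measurableSet_Ioo.prod measurableSet_ball)).mono ?_
  rintro ⟨t, x⟩ hz
  exact hK t hz.1 x hz.2

/-- **J′'s class is empty on the blow-up branch** (no local Type I singular point ⇒ no Full-Morrey frame
blow-up): a frame blow-up (`¬ HasSmoothExtensionPast`) is never `FullMorreyTypeINear`.  CONDITIONAL on `hno`. -/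
theorem not_fullMorreyTypeINear_of_blowup (hno : ¬ LocalTypeISingularityExists)
    (hν : 0 < ν) (hT : 0 < T) (hsol : IsClassicalNSSolutionOn (Ico 0 T) ν 0 u p)
    (hLH : IsLerayHopfOn T ν 0 (u 0) u) (hdec : HasRapidSpatialDecay (u 0))
    (hbu : ¬ HasSmoothExtensionPast ν 0 u T) : ¬ FullMorreyTypeINear u T :=
  fun hF => hbu (hasSmoothExtensionPast_of_fullMorreyTypeINear hno hν hT hsol hLH hdec hF)

/-- **A Morrey-Type-I frame blow-up is sub-parabolically Morrey-Type-II** (no local Type I singular point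
assumed): on stub 2's class `MorreyTypeINear` (Barker–Prange (1.7) on the top windows `T - r² < t < T`) a
blow-up violates the sub-parabolic Morrey bound `SubparabolicMorreyNear` — for every `M` and every final
window there are a late time `t`, a centre and a radius `r ≤ √(T-t)` with `∫_{B(x₀,r)}|u(t)|² > M r` — since
top ∧ bottom is the Full-Morrey bound (`fullMorreyTypeINear_of_morreyTypeI_of_subparabolic`).
CONDITIONAL on `hno`. -/
theorem not_subparabolicMorreyNear_of_morreyTypeI_blowup (hno : ¬ LocalTypeISingularityExists)
    (hν : 0 < ν) (hT : 0 < T) (hsol : IsClassicalNSSolutionOn (Ico 0 T) ν 0 u p)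
    (hLH : IsLerayHopfOn T ν 0 (u 0) u) (hdec : HasRapidSpatialDecay (u 0))
    (hbu : ¬ HasSmoothExtensionPast ν 0 u T) (hM : MorreyTypeINear u T) :
    ¬ SubparabolicMorreyNear u T :=
  fun hS => not_fullMorreyTypeINear_of_blowup hno hν hT hsol hLH hdec hbu
    (fullMorreyTypeINear_of_morreyTypeI_of_subparabolic hM hS)

/-- The negated sub-parabolic bound, unfolded: for every `M > 0` and every `T₁ < T` some late slice carries
`L²`-energy `> M r` on some sub-parabolic ball `B(x₀, r)`, `0 < r`, `r² ≤ T - t`. -/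
theorem exists_subparabolic_concentration_of_not_subparabolicMorreyNear
    (h : ¬ SubparabolicMorreyNear u T) {M : ℝ} (hM : 0 < M) {T₁ : ℝ} (hT₁ : T₁ < T) :
    ∃ t ∈ Ioo T₁ T, ∃ x₀ : EuclideanSpace ℝ (Fin 3), ∃ r : ℝ, 0 < r ∧ r ^ 2 ≤ T - t ∧
      ENNReal.ofReal (M * r) < ∫⁻ x in ball x₀ r, ‖u t x‖ₑ ^ 2 := by
  by_contra hcon
  push Not at hcon
  exact h ⟨M, hM, T₁, hT₁, fun t ht x₀ r hr hrs => hcon t ht x₀ r hr hrs⟩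

/-- **Deep sub-parabolic `L²` concentration on Morrey-Type-I blow-ups** (no local Type I singular point
assumed): a frame blow-up in stub 2's class has, for every `M > 0` and in every final window, a slice with
`∫_{B(x₀,r)}|u(t)|² > M r` on a ball of sub-parabolic radius `r ≤ √(T-t)`.  CONDITIONAL on `hno`. -/
theorem exists_subparabolic_concentration_of_morreyTypeI_blowup (hno : ¬ LocalTypeISingularityExists)
    (hν : 0 < ν) (hT : 0 < T) (hsol : IsClassicalNSSolutionOn (Ico 0 T) ν 0 u p)
    (hLH : IsLerayHopfOn T ν 0 (u 0) u) (hdec : HasRapidSpatialDecay (u 0))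
    (hbu : ¬ HasSmoothExtensionPast ν 0 u T) (hM : MorreyTypeINear u T)
    {M : ℝ} (hMpos : 0 < M) {T₁ : ℝ} (hT₁ : T₁ < T) :
    ∃ t ∈ Ioo T₁ T, ∃ x₀ : EuclideanSpace ℝ (Fin 3), ∃ r : ℝ, 0 < r ∧ r ^ 2 ≤ T - t ∧
      ENNReal.ofReal (M * r) < ∫⁻ x in ball x₀ r, ‖u t x‖ₑ ^ 2 :=
  exists_subparabolic_concentration_of_not_subparabolicMorreyNear
    (not_subparabolicMorreyNear_of_morreyTypeI_blowup hno hν hT hsol hLH hdec hbu hM) hMpos hT₁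

/-! ## §3  Stub 2 and the crux on the MTI class are their sub-parabolic-Type-II residuals -/

/-- **Stub 2 on the Full-Morrey class holds vacuously** (no local Type I singular point assumed): the
registered stub `stub_morreyTypeI_slow` restricted to blow-ups that are ALSO sub-parabolically Morrey-Type-I
has no instance.  CONDITIONAL on `hno`. -/
theorem l3Slow_of_fullMorrey_blowup (hno : ¬ LocalTypeISingularityExists)
    (hν : 0 < ν) (hT : 0 < T) (hsol : IsClassicalNSSolutionOn (Ico 0 T) ν 0 u p)
    (hLH : IsLerayHopfOn T ν 0 (u 0) u) (hdec : HasRapidSpatialDecay (u 0))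
    (hbu : ¬ HasSmoothExtensionPast ν 0 u T) (hF : FullMorreyTypeINear u T) : L3Slow u T :=
  absurd hF (not_fullMorreyTypeINear_of_blowup hno hν hT hsol hLH hdec hbu)

/-- **Stub 2 ≡ its residual** (no local Type I singular point assumed): `MorreyTypeISlowB` — the registered
signature of `stub_morreyTypeI_slow` as the tree's typed node — is equivalent to the same implication demanded
only of blow-ups that are Morrey-Type-I on the top windows but NOT sub-parabolically
(`MorreyTypeINear u T ∧ ¬ SubparabolicMorreyNear u T`).  CONDITIONAL on `hno`. -/
theorem morreyTypeISlowB_iff_residual (hno : ¬ LocalTypeISingularityExists) :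
    MorreyTypeISlowB ↔
      ∀ (ν T : ℝ), 0 < ν → 0 < T →
        ∀ (u : ℝ → EuclideanSpace ℝ (Fin 3) → EuclideanSpace ℝ (Fin 3)) (p : ℝ → EuclideanSpace ℝ (Fin 3) → ℝ),
          IsClassicalNSSolutionOn (Ico 0 T) ν 0 u p → IsLerayHopfOn T ν 0 (u 0) u →
          HasRapidSpatialDecay (u 0) → ¬ HasSmoothExtensionPast ν 0 u T → MorreyTypeINear u T →
          ¬ SubparabolicMorreyNear u T → L3Slow u T := by
  refine ⟨fun h ν T hν hT u p hsol hLH hdec hbu hM _ => h ν T hν hT u p hsol hLH hdec hbu hM,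
    fun h ν T hν hT u p hsol hLH hdec hbu hM => ?_⟩
  exact h ν T hν hT u p hsol hLH hdec hbu hM
    (not_subparabolicMorreyNear_of_morreyTypeI_blowup hno hν hT hsol hLH hdec hbu hM)

/-- **The crux on the MTI class ≡ its residual** (no local Type I singular point assumed): `EffSatBlowupMTI`
(the crux `EffSatBlowup` restricted to Morrey-Type-I blow-ups) is equivalent to the `K₃(1)` clause demanded
only of the sub-parabolically Morrey-Type-II ones.  CONDITIONAL on `hno`. -/
theorem effSatBlowupMTI_iff_residual (hno : ¬ LocalTypeISingularityExists) :
    EffSatBlowupMTI ↔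
      ∀ (ν T : ℝ), 0 < ν → 0 < T →
        ∀ (u : ℝ → EuclideanSpace ℝ (Fin 3) → EuclideanSpace ℝ (Fin 3)) (p : ℝ → EuclideanSpace ℝ (Fin 3) → ℝ),
          IsClassicalNSSolutionOn (Ico 0 T) ν 0 u p → IsLerayHopfOn T ν 0 (u 0) u →
          HasRapidSpatialDecay (u 0) → ¬ HasSmoothExtensionPast ν 0 u T → MorreyTypeINear u T →
          ¬ SubparabolicMorreyNear u T → EffSatNear u T := by
  refine ⟨fun h ν T hν hT u p hsol hLH hdec hbu hM _ => h ν T hν hT u p hsol hLH hdec hbu hM,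
    fun h ν T hν hT u p hsol hLH hdec hbu hM => ?_⟩
  exact h ν T hν hT u p hsol hLH hdec hbu hM
    (not_subparabolicMorreyNear_of_morreyTypeI_blowup hno hν hT hsol hLH hdec hbu hM)

/-- **The crux itself ≡ the crux off the Full-Morrey class** (no local Type I singular point assumed):
`EffSatBlowup` is equivalent to its restriction to blow-ups that are NOT `FullMorreyTypeINear`.
CONDITIONAL on `hno`. -/
theorem effSatBlowup_iff_offFullMorrey (hno : ¬ LocalTypeISingularityExists) :
    EffSatBlowup ↔
      ∀ (ν T : ℝ), 0 < ν → 0 < T →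
        ∀ (u : ℝ → EuclideanSpace ℝ (Fin 3) → EuclideanSpace ℝ (Fin 3)) (p : ℝ → EuclideanSpace ℝ (Fin 3) → ℝ),
          IsClassicalNSSolutionOn (Ico 0 T) ν 0 u p → IsLerayHopfOn T ν 0 (u 0) u →
          HasRapidSpatialDecay (u 0) → ¬ HasSmoothExtensionPast ν 0 u T → ¬ FullMorreyTypeINear u T →
          EffSatNear u T := by
  refine ⟨fun h ν T hν hT u p hsol hLH hdec hbu _ => h ν T hν hT u p hsol hLH hdec hbu,
    fun h ν T hν hT u p hsol hLH hdec hbu => ?_⟩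
  exact h ν T hν hT u p hsol hLH hdec hbu (not_fullMorreyTypeINear_of_blowup hno hν hT hsol hLH hdec hbu)

/-! ## §4  The parent jaw's Morrey-side node gives Clay (A) under the same hypothesis -/

/-- **`AllBlowupsFullMorreyB ⇒ Clay (A)`, if no local Type I singular point exists.**  The Morrey-side node of
the parent crux `L3CascadeJaw` ("every frame blow-up is Full-Morrey-Type-I near `T`", p4's
`AllBlowupsFullMorreyB`, implied by hard core 0056) contradicts `not_fullMorreyTypeINear_of_blowup` on every
blow-up, so the frame has no blow-up and the route's landed `NoBlowupToClay` (item 19501) applies.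
A REDUCTION certificate: both hypotheses are open. -/
theorem navierStokesRegularity_of_allBlowupsFullMorreyB (hno : ¬ LocalTypeISingularityExists)
    (hA : AllBlowupsFullMorreyB) : NavierStokesRegularity := by
  refine L3TimeExponentPincerNoBlowupToClay.noBlowupToClay_item fun ν T hν hT u p hsol hLH hdec => ?_
  by_contra hbu
  exact not_fullMorreyTypeINear_of_blowup hno hν hT hsol hLH hdec hbu (hA ν T hν hT u p hsol hLH hdec hbu)

/-! ## §5  The same under hard core `stmt-NavierStokesRegularity-10661` (L) BY NAME -/

/-- Hard core 10661 (`Theses.TypeILiouville.TypeIliouvilleL`, the KNSS Liouville conjecture (L) as a route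
decl) excludes local Type I singular points (the tree's kernel-checked Albritton–Barker forward blow-up +
"constants have `𝐈 = ∞`", `not_localTypeISingularityExists_of_liouvilleConjectureNS`). -/
theorem not_localTypeISingularityExists_of_typeIliouvilleL
    (hL : Summit.NavierStokesRegularity.NavierStokesRegularity.Theses.TypeILiouville.TypeIliouvilleL) :
    ¬ LocalTypeISingularityExists :=
  not_localTypeISingularityExists_of_liouvilleConjectureNS fun v hv hmeas t ht => hL v hv hmeas t ht

/-- **(L) kills Full-Morrey blow-ups**: under hard core 10661 no frame blow-up is `FullMorreyTypeINear` — the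
Morrey-(1.7) companion of the landed item 10662 "(L) kills Type I blow-up" (pointwise rate), for J′'s class. -/
theorem not_fullMorreyTypeINear_of_blowup_of_typeIliouvilleL
    (hL : Summit.NavierStokesRegularity.NavierStokesRegularity.Theses.TypeILiouville.TypeIliouvilleL)
    (hν : 0 < ν) (hT : 0 < T) (hsol : IsClassicalNSSolutionOn (Ico 0 T) ν 0 u p)
    (hLH : IsLerayHopfOn T ν 0 (u 0) u) (hdec : HasRapidSpatialDecay (u 0))
    (hbu : ¬ HasSmoothExtensionPast ν 0 u T) : ¬ FullMorreyTypeINear u T :=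
  not_fullMorreyTypeINear_of_blowup (not_localTypeISingularityExists_of_typeIliouvilleL hL)
    hν hT hsol hLH hdec hbu

/-- **(L) ⇒ Morrey-Type-I blow-ups concentrate sub-parabolically**: under hard core 10661 every frame blow-up
in stub 2's class `MorreyTypeINear` violates `SubparabolicMorreyNear`. -/
theorem not_subparabolicMorreyNear_of_morreyTypeI_blowup_of_typeIliouvilleL
    (hL : Summit.NavierStokesRegularity.NavierStokesRegularity.Theses.TypeILiouville.TypeIliouvilleL)
    (hν : 0 < ν) (hT : 0 < T) (hsol : IsClassicalNSSolutionOn (Ico 0 T) ν 0 u p)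
    (hLH : IsLerayHopfOn T ν 0 (u 0) u) (hdec : HasRapidSpatialDecay (u 0))
    (hbu : ¬ HasSmoothExtensionPast ν 0 u T) (hM : MorreyTypeINear u T) :
    ¬ SubparabolicMorreyNear u T :=
  not_subparabolicMorreyNear_of_morreyTypeI_blowup (not_localTypeISingularityExists_of_typeIliouvilleL hL)
    hν hT hsol hLH hdec hbu hM

/-- **Stub 2 ≡ its residual under (L)** (hard core 10661 BY NAME). -/
theorem morreyTypeISlowB_iff_residual_of_typeIliouvilleL
    (hL : Summit.NavierStokesRegularity.NavierStokesRegularity.Theses.TypeILiouville.TypeIliouvilleL) :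
    MorreyTypeISlowB ↔
      ∀ (ν T : ℝ), 0 < ν → 0 < T →
        ∀ (u : ℝ → EuclideanSpace ℝ (Fin 3) → EuclideanSpace ℝ (Fin 3)) (p : ℝ → EuclideanSpace ℝ (Fin 3) → ℝ),
          IsClassicalNSSolutionOn (Ico 0 T) ν 0 u p → IsLerayHopfOn T ν 0 (u 0) u →
          HasRapidSpatialDecay (u 0) → ¬ HasSmoothExtensionPast ν 0 u T → MorreyTypeINear u T →
          ¬ SubparabolicMorreyNear u T → L3Slow u T :=
  morreyTypeISlowB_iff_residual (not_localTypeISingularityExists_of_typeIliouvilleL hL)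

/-- **`AllBlowupsFullMorreyB ∧ (L) ⇒ Clay (A)`** — the parent jaw's Morrey-side node meets hard core 10661:
together they give `NavierStokesRegularity`.  A REDUCTION certificate (both hypotheses open), not a candidate
proof of any item. -/
theorem navierStokesRegularity_of_allBlowupsFullMorreyB_of_typeIliouvilleL
    (hL : Summit.NavierStokesRegularity.NavierStokesRegularity.Theses.TypeILiouville.TypeIliouvilleL)
    (hA : AllBlowupsFullMorreyB) : NavierStokesRegularity :=
  navierStokesRegularity_of_allBlowupsFullMorreyB (not_localTypeISingularityExists_of_typeIliouvilleL hL) hA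

end Summit.NavierStokesRegularity.NavierStokesRegularity.Theorems.L3TimeExponentPincerFullMorreyHardCoreMeet

end
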